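import Summits.BirchSwinnertonDyer.BirchSwinnertonDyer.Theorems.SignedBaseChangeAnticyclotomicEisensteinDivisibilityAdmdefAnchorOfNV
import Summits.BirchSwinnertonDyer.BirchSwinnertonDyer.Theorems.SignedBaseChangeAnticyclotomicEisensteinDivisibilityAdmdefSignedDetour
import Summits.BirchSwinnertonDyer.BirchSwinnertonDyer.Theorems.SignedBaseChangeAnticyclotomicEisensteinDivisibilityOfStubsAdmdefV13
import Summits.BirchSwinnertonDyer.BirchSwinnertonDyer.Theorems.SignedBaseChangeAnticyclotomicEisensteinDivisibilityOfStubsAdmdefV14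
import HarnessLib

/-!
# Line `admdef` (crux `AnticyclotomicEisensteinDivisibility`, stmt-BirchSwinnertonDyer-20727): on cell β, «K1's conclusion at EVERY odd zero vertex»
# ⟺ [NV] — Howard's non-triviality hypothesis IS the anchor (kernel, in the crux frame, modulo {HLV 3.7 local}, (Par)/DD10, the dictionary and
# multiplicity one mod `p`)

LEAD seat bsd-line-sbc-p1 (gen 33), `--supports stmt-BirchSwinnertonDyer-20727` (helper; OFF the v24 composition path; sequel of `…AdmdefAnchorOfNV`).

`…AdmdefAnchorOfNV.anchor_of_hasUnitLambda` (g33) is ⟹.  Here ⟸: if at EVERY odd zero vertex `s` of the level-raised Selmer walk there are definite Brandt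
data at level `N·∏s` with non-zero WEIGHTED toric period (the conclusion of the anchor K1 = item stmt-BirchSwinnertonDyer-33118), then [NV]
`B.HasUnitLambda N` — because an odd zero vertex EXISTS (W. Zhang's walk with the signed detour, LEAD g18 `…AdmdefSignedDetour.exists_oddZeroVertex_bothSigns_of_split`,
fed by (Par)), multiplicity one mod `p` on the definite side (`hmult`, the shape of cite (15) KO23/PW11) moves the non-vanishing to the JL vector of the
dictionary (`hdict`, cite (16)), and the dictionary gives `λ_1(∏s)(0) ∈ ℤ_pˣ`, i.e. [NV] at `j = 1`.  ★★★ `hasUnitLambda_iff_forall_anchor`: the two are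
EQUIVALENT; `…_of_dokchitser`: binder shape of the line ((Par) discharged from Cassels–Tate + DD10).  READING for the planner: on cell β the registered
research text of item 33118 (an `∀`-vertex statement) and Howard's one-vertex non-triviality [NV] (CHKLL25 Thm. 7.6's conclusion without its square-free
hypothesis) are the same statement modulo named print facts — in kernel.

HONEST FRAMING: theorems only (0 definitions, 0 named facts, 0 `sorry`; standard axioms); `hdict`, `hmult`, {HLV 3.7 local} (and DD10) are HYPOTHESES;
nothing here proves [NV], K1, the crux or BSD; no summit statement is proved.

References: [cite: Howard2006, Thm. 3.2.3 (c)] [cite: Howard2006Bipartite, Thm. 2.5.1] [cite: CastellaEtAl2025, Thm. 7.4, (7.4), Thm. 7.5, Thm. 7.6, §7.4 (arXiv:2308.10474v2 pp. 30–33)]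
[cite: WZhang2014, Prop. 5.4, Lemma 7.3, Thm. 9.1] [cite: KimOta2023, Thm. 5.5, Cor. 5.7] [cite: PollackWeston2011, Thm. 6.2] [cite: HatleyLeiVigni2022, Lemma 3.7]
[cite: DokchitserDokchitserAnnals2010, §4.6, Thm. 4.19]
-/

-- D-0017: single-problem summit, the namespace repeats the problem name by design.
set_option linter.dupNamespace false
set_option autoImplicit false

noncomputable section

open scoped Classical NumberField Pointwise

namespace Summit.BirchSwinnertonDyer.BirchSwinnertonDyer.Theorems.SignedBaseChangeAcDivAdmdefAnchorIffNV

open WeierstrassCurve NumberField IsDedekindDomain Field Module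
open Literature.NumberTheory.EllipticCurves Literature.NumberTheory.GaloisRepresentations Literature.NumberTheory.GaloisCohomology
open Literature.NumberTheory.EllipticCurves.CastellaHsuKunduLeeLiu2025
open Literature.NumberTheory.EllipticCurves.BertoliniDarmon2005
open Literature.NumberTheory.EllipticCurves.AcSigned
open Literature.NumberTheory.EllipticCurves.Rank1Residual
open Literature.NumberTheory.Automorphic
open Summit.BirchSwinnertonDyer.BirchSwinnertonDyer.Theorems.AdditiveKoly
open Summit.BirchSwinnertonDyer.BirchSwinnertonDyer.Theorems.SignedBaseChangeAcDivAdmdefHowardRigidity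
open Summit.BirchSwinnertonDyer.BirchSwinnertonDyer.Theorems.SignedBaseChangeAcDivAdmdefAnchorOfNV

universe u

/-! ## §1 (The linear algebra of the weighted toric period — `toricPeriod_smul`, `weight_mul_smul` — is reused from the landed census files
`…OfStubsAdmdefV13` / `…OfStubsAdmdefV14`.) -/

section Main

variable {K : Type} [Field K] [NumberField K] {W : WeierstrassCurve ℚ} [W.IsElliptic] [W.IsGloballyMinimal] {p : ℕ} [Fact p.Prime]
  {κ : ZpExtension K p} {γ : absoluteGaloisGroup K} {N : ℕ} {ε : ℤˣ} {B : SignedBipartiteSystem W K p κ} {𝔭 𝔭' : HeightOneSpectrum (𝓞 K)}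
  (c : K ≃ₐ[ℚ] K) [Module (ZMod p) (Vp W K p)]

omit [W.IsElliptic] [Module (ZMod p) (Vp W K p)] in
/-- **⟸, the bridge direction at ONE vertex** (cell-free in the Selmer data): definite Brandt data with non-zero weighted toric period at an odd level `s`,
multiplicity one mod `p` (`hmult`, KO23 Thm. 5.5 / PW11 Thm. 6.2 shape) and the dictionary (`hdict`, CHKLL25 Thm. 7.4 with (7.4)) give `λ_1(∏s)(0) ∈ ℤ_pˣ`,
hence [NV] `B.HasUnitLambda N` (at `j = 1`, `m = ∏s ∈ 𝒩_1^def`).  The argument of the skeleton's `bridge_of_spec`, in Theorems currency.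
[cite: CastellaEtAl2025, Thm. 7.4, (7.4), Thm. 7.5, §7.4] [cite: KimOta2023, Thm. 5.5, Cor. 5.7] [cite: PollackWeston2011, Thm. 6.2] -/
theorem hasUnitLambda_of_anchorAt [NeZero N] (hN : (N : ℤ) = W.conductorNorm ℤ)
    (hdict : ∀ m ∈ defProducts N K (fun ℓ ↦ W.frobeniusTrace ℓ) p 1, ∀ (S : Brandt.XiSetup N m),
      ∃ φ : Brandt.ClassSet S.O → ZMod p, φ ≠ 0 ∧
        (letI : Fintype (Brandt.ClassSet S.O) := Fintype.ofFinite _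
         φ ∈ Brandt.eigenSpace (ZMod p) (N * m) (Brandt.matrix S.O) (fun ℓ ↦ W.frobeniusTrace ℓ)) ∧
        ∀ (ψ : K →ₐ[ℚ] S.D) (I : Submodule ℤ S.D), Brandt.IsGrossPoint S.O ψ I →
          (IsUnit (PowerSeries.constantCoeff (B.lam 1 m)) ↔ Brandt.toricPeriod S.O ψ I (fun i ↦ (Brandt.weight S.O i : ZMod p) * φ i) ≠ 0))
    (hmult : ∀ m ∈ defProducts N K (fun ℓ ↦ W.frobeniusTrace ℓ) p 1, ∀ (S : Brandt.XiSetup N m)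
      (φ₁ φ₂ : Brandt.ClassSet S.O → ZMod p),
      (letI : Fintype (Brandt.ClassSet S.O) := Fintype.ofFinite _
       φ₁ ∈ Brandt.eigenSpace (ZMod p) (N * m) (Brandt.matrix S.O) (fun ℓ ↦ W.frobeniusTrace ℓ)) →
      (letI : Fintype (Brandt.ClassSet S.O) := Fintype.ofFinite _
       φ₂ ∈ Brandt.eigenSpace (ZMod p) (N * m) (Brandt.matrix S.O) (fun ℓ ↦ W.frobeniusTrace ℓ)) →
      φ₁ ≠ 0 → ∃ a : ZMod p, φ₂ = a • φ₁)
    {s : Finset (AdmQ W K p)} (hs : Odd s.card)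
    (hanch : ∃ (S : Brandt.XiSetup N (∏ q ∈ s.image Subtype.val, q)) (ψ : K →ₐ[ℚ] S.D) (I : Submodule ℤ S.D)
      (φ : Brandt.ClassSet S.O → ZMod p),
      Brandt.IsGrossPoint S.O ψ I ∧
      (letI : Fintype (Brandt.ClassSet S.O) := Fintype.ofFinite _
       φ ∈ Brandt.eigenSpace (ZMod p) (N * ∏ q ∈ s.image Subtype.val, q) (Brandt.matrix S.O) (fun ℓ ↦ W.frobeniusTrace ℓ)) ∧
      Brandt.toricPeriod S.O ψ I (fun i ↦ (Brandt.weight S.O i : ZMod p) * φ i) ≠ 0) :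
    IsUnit (PowerSeries.constantCoeff (B.lam 1 (∏ r ∈ s, (r : ℕ)))) ∧ B.HasUnitLambda N := by
  rw [prod_image_val_eq_prod] at hanch
  obtain ⟨S, ψ, I, φ, hG, hφ, hper⟩ := hanch
  have hm : (∏ r ∈ s, (r : ℕ)) ∈ defProducts N K (fun ℓ ↦ W.frobeniusTrace ℓ) p 1 := prod_mem_defProducts_of_odd hN hs
  obtain ⟨φg, hφg0, hφg, hiff⟩ := hdict _ hm S
  obtain ⟨a, ha⟩ := hmult _ hm S φg φ hφg hφ hφg0
  have hPg : Brandt.toricPeriod S.O ψ I (fun i ↦ (Brandt.weight S.O i : ZMod p) * φg i) ≠ 0 := by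
    intro h0
    apply hper
    rw [ha, SignedBaseChangeAcDivOfStubsAdmdefV14.weight_mul_smul, SignedBaseChangeAcDivOfStubsAdmdefV13.toricPeriod_smul, h0, smul_zero]
  have hlam : IsUnit (PowerSeries.constantCoeff (B.lam 1 (∏ r ∈ s, (r : ℕ)))) := (hiff ψ I hG).mpr hPg
  exact ⟨hlam, (B.hasUnitLambda_iff N).mpr ⟨1, one_pos, _, hm, hlam⟩⟩

/-- ★★★ **ON CELL β, «K1's conclusion at EVERY odd zero vertex» ⟺ [NV].**  Frame: CHKLL25's signed bipartite system `B` of sign `ε` at level `N = N_E ≥ 1`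
(`hB`), `AcSigned.Setting`, {HLV 3.7 local}, `p ≥ 5`, `ρ̄` onto, every `ℓ ∣ N` split, `p` split, `(N, d_K) = 1`, binder (ii), `c ≠ 1`, ODD bottom
dimension ((Par)), the dictionary clause of cite (16) for THIS system (`hdict`) and multiplicity one mod `p` on the definite side (`hmult`, cite (15)).  THEN:
`B.HasUnitLambda N` **iff** at every odd zero vertex `s` (`SelQP W K p c s ± = ⊥`) there are `S : XiSetup N (∏ q ∈ s.image val, q)`, a Gross point `(ψ, I)`
and a mod-`p` `a(E)`-eigenvector `φ` with non-zero WEIGHTED toric period — the conclusion of item stmt-BirchSwinnertonDyer-33118 `…DefiniteAnchorNonFW`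
VERBATIM.  ⟹ is `…AdmdefAnchorOfNV.anchor_of_hasUnitLambda` (Howard 3.2.3 (c) mod 𝔪 PT-free + set-up and Gross-point existence at non-square-free level);
⟸: an odd zero vertex EXISTS (`…AdmdefSignedDetour.exists_oddZeroVertex_bothSigns_of_split`, W. Zhang's walk + signed detour from (Par)) and
`hasUnitLambda_of_anchorAt`.  All of `hdict`, `hmult`, {HLV 3.7 local} are HYPOTHESES.
[cite: Howard2006, Thm. 3.2.3 (c)] [cite: CastellaEtAl2025, Thm. 7.4, (7.4), Thm. 7.5, Thm. 7.6, §7.4] [cite: WZhang2014, Prop. 5.4, Lemma 7.3, Thm. 9.1]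
[cite: KimOta2023, Thm. 5.5, Cor. 5.7] [cite: HatleyLeiVigni2022, Lemma 3.7] [cite: BertoliniDarmon1996, Lemma 2.1] -/
theorem hasUnitLambda_iff_forall_anchor [NeZero N] (hB : IsSignedBipartiteSystem W K p κ γ N ε B) (hS : Setting W K p κ 𝔭 𝔭')
    (hloc : hatleyLeiVigni2022_lemma37_local_signedCondition_eq_kummer W K p κ 𝔭 𝔭')
    (hN : (N : ℤ) = W.conductorNorm ℤ) (h5 : 5 ≤ p) (hsurj : W.HasSurjectiveModNGaloisRep p)
    (hHeeg : ∀ ℓ : ℕ, ℓ.Prime → ℓ ∣ N → ((Ideal.span {(ℓ : ℤ)}).primesOver (𝓞 K)).ncard = 2)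
    (hsp : ((Ideal.span {(p : ℤ)}).primesOver (𝓞 K)).ncard = 2) (hND : IsCoprime (N : ℤ) (NumberField.discr K))
    (hall : ∀ q : ℕ, q.Prime → q ∣ N → ∃ v' : HeightOneSpectrum (𝓞 ℚ), ((q : ℕ) : 𝓞 ℚ) ∈ v'.asIdeal ∧
      ∃ 𝔓 ∈ v'.primesAbove, ∃ σ ∈ 𝔓.inertia (absoluteGaloisGroup ℚ), ∃ P : W.geomTorsion (p : ℤ), σ • P ≠ P)
    (hc1 : c ≠ 1) (hodd : Odd (finrank (ZMod p) (SelQP W K p c ∅ true) + finrank (ZMod p) (SelQP W K p c ∅ false)))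
    (hdict : ∀ m ∈ defProducts N K (fun ℓ ↦ W.frobeniusTrace ℓ) p 1, ∀ (S : Brandt.XiSetup N m),
      ∃ φ : Brandt.ClassSet S.O → ZMod p, φ ≠ 0 ∧
        (letI : Fintype (Brandt.ClassSet S.O) := Fintype.ofFinite _
         φ ∈ Brandt.eigenSpace (ZMod p) (N * m) (Brandt.matrix S.O) (fun ℓ ↦ W.frobeniusTrace ℓ)) ∧
        ∀ (ψ : K →ₐ[ℚ] S.D) (I : Submodule ℤ S.D), Brandt.IsGrossPoint S.O ψ I →
          (IsUnit (PowerSeries.constantCoeff (B.lam 1 m)) ↔ Brandt.toricPeriod S.O ψ I (fun i ↦ (Brandt.weight S.O i : ZMod p) * φ i) ≠ 0))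
    (hmult : ∀ m ∈ defProducts N K (fun ℓ ↦ W.frobeniusTrace ℓ) p 1, ∀ (S : Brandt.XiSetup N m)
      (φ₁ φ₂ : Brandt.ClassSet S.O → ZMod p),
      (letI : Fintype (Brandt.ClassSet S.O) := Fintype.ofFinite _
       φ₁ ∈ Brandt.eigenSpace (ZMod p) (N * m) (Brandt.matrix S.O) (fun ℓ ↦ W.frobeniusTrace ℓ)) →
      (letI : Fintype (Brandt.ClassSet S.O) := Fintype.ofFinite _
       φ₂ ∈ Brandt.eigenSpace (ZMod p) (N * m) (Brandt.matrix S.O) (fun ℓ ↦ W.frobeniusTrace ℓ)) →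
      φ₁ ≠ 0 → ∃ a : ZMod p, φ₂ = a • φ₁) :
    B.HasUnitLambda N ↔
      ∀ s : Finset (AdmQ W K p), Odd s.card → (∀ μ : Bool, SelQP W K p c s μ = ⊥) →
        ∃ (S : Brandt.XiSetup N (∏ q ∈ s.image Subtype.val, q)) (ψ : K →ₐ[ℚ] S.D) (I : Submodule ℤ S.D)
          (φ : Brandt.ClassSet S.O → ZMod p),
          Brandt.IsGrossPoint S.O ψ I ∧
          (letI : Fintype (Brandt.ClassSet S.O) := Fintype.ofFinite _
           φ ∈ Brandt.eigenSpace (ZMod p) (N * ∏ q ∈ s.image Subtype.val, q) (Brandt.matrix S.O) (fun ℓ ↦ W.frobeniusTrace ℓ)) ∧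
          Brandt.toricPeriod S.O ψ I (fun i ↦ (Brandt.weight S.O i : ZMod p) * φ i) ≠ 0 := by
  refine ⟨fun hNV s hs hzero ↦ anchor_of_hasUnitLambda c hB hS hloc hN h5 hsurj hHeeg hsp hND hall hc1 hodd hdict hNV hs hzero, fun hanch ↦ ?_⟩
  have hN' : N = W.conductorNorm ℤ := by exact_mod_cast hN
  have hH : SatisfiesHeegnerHypothesis (W.conductorNorm ℤ) K := fun ℓ hℓ hℓN ↦ hHeeg ℓ hℓ (hN' ▸ hℓN)
  -- an odd zero vertex exists (W. Zhang's walk + the signed detour on β)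
  obtain ⟨n, hnodd, -, hnzero, -⟩ :=
    SignedBaseChangeAcDivAdmdefSignedDetour.exists_oddZeroVertex_bothSigns_of_split W K p h5 hsurj hS.isImaginaryQuadratic hH hsp hc1 hodd
  exact (hasUnitLambda_of_anchorAt hN hdict hmult hnodd (hanch n hnodd hnzero)).2

/-- ★★★ **The same equivalence, binder shape of the line** ((Par) DISCHARGED: Cassels–Tate is a tree theorem, `rk_p(E/K)` odd is the named print fact
Dokchitser–Dokchitser 2010 §4.6 step (4); `ρ̄` onto as `Rank1Residual.Surj`). [cite: Howard2006, Thm. 3.2.3 (c)] [cite: CastellaEtAl2025, Thm. 7.4, Thm. 7.5, Thm. 7.6, §7.4]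
[cite: DokchitserDokchitserAnnals2010, §4.6, Thm. 4.19] [cite: KimOta2023, Thm. 5.5, Cor. 5.7] [cite: HatleyLeiVigni2022, Lemma 3.7] -/
theorem hasUnitLambda_iff_forall_anchor_of_dokchitser [NeZero N] (hDD : dokchitser_selmerCorank_baseChange_mod_two_eq)
    (hB : IsSignedBipartiteSystem W K p κ γ N ε B) (hS : Setting W K p κ 𝔭 𝔭')
    (hloc : hatleyLeiVigni2022_lemma37_local_signedCondition_eq_kummer W K p κ 𝔭 𝔭')
    (hN : (N : ℤ) = W.conductorNorm ℤ) (h5 : 5 ≤ p) (hsurj : Surj W p)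
    (hHeeg : ∀ ℓ : ℕ, ℓ.Prime → ℓ ∣ N → ((Ideal.span {(ℓ : ℤ)}).primesOver (𝓞 K)).ncard = 2)
    (hsp : ((Ideal.span {(p : ℤ)}).primesOver (𝓞 K)).ncard = 2) (hND : IsCoprime (N : ℤ) (NumberField.discr K))
    (hall : ∀ q : ℕ, q.Prime → q ∣ N → ∃ v' : HeightOneSpectrum (𝓞 ℚ), ((q : ℕ) : 𝓞 ℚ) ∈ v'.asIdeal ∧
      ∃ 𝔓 ∈ v'.primesAbove, ∃ σ ∈ 𝔓.inertia (absoluteGaloisGroup ℚ), ∃ P : W.geomTorsion (p : ℤ), σ • P ≠ P)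
    (hc1 : c ≠ 1)
    (hdict : ∀ m ∈ defProducts N K (fun ℓ ↦ W.frobeniusTrace ℓ) p 1, ∀ (S : Brandt.XiSetup N m),
      ∃ φ : Brandt.ClassSet S.O → ZMod p, φ ≠ 0 ∧
        (letI : Fintype (Brandt.ClassSet S.O) := Fintype.ofFinite _
         φ ∈ Brandt.eigenSpace (ZMod p) (N * m) (Brandt.matrix S.O) (fun ℓ ↦ W.frobeniusTrace ℓ)) ∧
        ∀ (ψ : K →ₐ[ℚ] S.D) (I : Submodule ℤ S.D), Brandt.IsGrossPoint S.O ψ I →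
          (IsUnit (PowerSeries.constantCoeff (B.lam 1 m)) ↔ Brandt.toricPeriod S.O ψ I (fun i ↦ (Brandt.weight S.O i : ZMod p) * φ i) ≠ 0))
    (hmult : ∀ m ∈ defProducts N K (fun ℓ ↦ W.frobeniusTrace ℓ) p 1, ∀ (S : Brandt.XiSetup N m)
      (φ₁ φ₂ : Brandt.ClassSet S.O → ZMod p),
      (letI : Fintype (Brandt.ClassSet S.O) := Fintype.ofFinite _
       φ₁ ∈ Brandt.eigenSpace (ZMod p) (N * m) (Brandt.matrix S.O) (fun ℓ ↦ W.frobeniusTrace ℓ)) →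
      (letI : Fintype (Brandt.ClassSet S.O) := Fintype.ofFinite _
       φ₂ ∈ Brandt.eigenSpace (ZMod p) (N * m) (Brandt.matrix S.O) (fun ℓ ↦ W.frobeniusTrace ℓ)) →
      φ₁ ≠ 0 → ∃ a : ZMod p, φ₂ = a • φ₁) :
    B.HasUnitLambda N ↔
      ∀ s : Finset (AdmQ W K p), Odd s.card → (∀ μ : Bool, SelQP W K p c s μ = ⊥) →
        ∃ (S : Brandt.XiSetup N (∏ q ∈ s.image Subtype.val, q)) (ψ : K →ₐ[ℚ] S.D) (I : Submodule ℤ S.D)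
          (φ : Brandt.ClassSet S.O → ZMod p),
          Brandt.IsGrossPoint S.O ψ I ∧
          (letI : Fintype (Brandt.ClassSet S.O) := Fintype.ofFinite _
           φ ∈ Brandt.eigenSpace (ZMod p) (N * ∏ q ∈ s.image Subtype.val, q) (Brandt.matrix S.O) (fun ℓ ↦ W.frobeniusTrace ℓ)) ∧
          Brandt.toricPeriod S.O ψ I (fun i ↦ (Brandt.weight S.O i : ZMod p) * φ i) ≠ 0 := by
  have hCT : ∀ (K : Type) [Field K] [NumberField K], WeierstrassCurve.exists_casselsTate_pairing (K := K) :=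
    fun K _ _ ↦ GenusExact.CasselsTatePTcReal.exists_casselsTate_pairing_of_levelThetaDatum (K := K)
      fun V _ k hk _ e hμ hadd₁ hadd₂ _hgal halt _hnd =>
        ⟨levelThetaDatumEven V (2 ^ k) e hμ hadd₁ hadd₂ halt (Nat.even_pow.mpr ⟨even_two, hk.ne'⟩)⟩
  have hodd := SignedBaseChangeAcDivAdmdefOddSelmerDim.oddSelmerDim_of_casselsTate_of_dokchitser hCT hDD W K hN h5 hsurj
    hS.isImaginaryQuadratic hHeeg c hc1
  exact hasUnitLambda_iff_forall_anchor c hB hS hloc hN h5 hsurj hHeeg hsp hND hall hc1 hodd hdict hmult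

end Main

end Summit.BirchSwinnertonDyer.BirchSwinnertonDyer.Theorems.SignedBaseChangeAcDivAdmdefAnchorIffNV

end
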